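import Mathlib
import Summits.Ventures.PercRepro2.HCov
import Summits.Ventures.PercRepro2.BHKAvoid
import Summits.Ventures.PercRepro2.ExploreA3
import Summits.Ventures.PercRepro2.RootLeafUSigns
import Summits.Ventures.PercRepro2.RootLeafUHalf
import Summits.Ventures.PercRepro2.RootLeafUCore
import Summits.Ventures.PercRepro2.RootLeafUYA
import Summits.Ventures.PercRepro2.RootLeafUSepIndep
import Summits.Ventures.PercRepro2.RootLeafUSepK
import Summits.Ventures.PercRepro2.RootLeafUSepB
import Summits.Ventures.PercRepro2.RootLeafUSepUO

/-!
# (G4-u) on the class «`u` separates the root `a₂` from `o`», part 2: the `o ∈ L` half and the class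
theorem (blind cell PercRepro2, p4 g9; S3 (G4-u), proofs/P4-G9-SEPUO.md)

THE CLASS (U-O-SEP): `∀ ω, Conn ω a₂ o → Conn ω a₂ u` (every `a₂–o` path passes through `u`).  Part 1
(RootLeafUSepUO.lean) has the `o ∈ K` half: `T2oK = ℰ·e0 ≥ 0`.  Here the `o ∈ L` half: with
`T2oL/2 = (YA) + (YB)` (`T2oL_eq_YA_add_YB`) and `YA_nonneg`, it suffices that
`(YB) = (d0·Z + D)·M + Y_N·B₀ − d0·P(Q,bL)·Y ≥ 0` (`M = P(T, oL, bL)`, `Y_N = P(PD, oL)`,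
`Y = P(PD, oL) + P(T, oL)`, `B₀ = P(PD, bL) + P(T′, bL)`, `P(Q, bL) = B₀ + B₁`, `B₁ = P(T, bL)`).
On the class the `u`-side is INDEPENDENT of the cluster `K = C(a₂)` under `Q`
(`SepK.prob_Q_clusterInK_conn_eq`, the mirror of RootLeafUSepIndep): `P(T, oL) = po·t`
(`po = P(u ↔ o)`), and — the new point — the residual `P(u ↔ o in G ∖ K)` is `po` on every `u`-avoiding
`a₂`-cluster (`Sep.conn_delConfig_iff` with the roles of `u` and `a₂` exchanged), so Harris in `G ∖ K`
gives **`M ≥ po · B₁`** (`prob_T_oL_bL_ge`).  With the mixed Harris bound `Y_N ≤ po·D` and the tower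
bound `Y_N ≥ d0·Y` (`prob_T_oL_le`):
  `(YB) = B₀·(Y_N − d0·Y) + [(d0·Z + D)·M − d0·B₁·Y] ≥ 0 + B₁·po·(d0·t′ + D) ≥ 0`
(`YB_nonneg_of_sepUO`).  Hence `0 ≤ T2oL`, `0 ≤ T2`, and **(G4-u) on the class is a THEOREM**
(`HCov_root_leaf_u_of_sepUO`) — the fifth cut-vertex class of S3.10 (G4-u), after (o) (p) (q) (t).
Own exact check: work/code/cexp/lab_uosep.py (session folder), 120 class instances, every step exact.
-/

namespace Summit.Ventures.PercRepro2

open UnionCluster CovForm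

namespace RootLeafU

namespace SepUO

section SepUOL

variable {V : Type*} {E : Type*} [Fintype E] [DecidableEq E] [Fintype V] [DecidableEq V]
  {R : Type*} [Field R] [LinearOrder R] [IsStrictOrderedRing R]

variable (p : E → R) (ends : E → Sym2 V) (o a₂ c b u : V)

omit [DecidableEq V] [LinearOrder R] [IsStrictOrderedRing R] in
/-- `P(T, oL) = P(u ↔ o) · P(T)` on the class (`u ↔ o` is independent of the cluster of `a₂` under `Q`,
`SepK.prob_Q_clusterInK_conn_eq` with `o` for `c`). -/
lemma prob_T_oL_eq (hsep : ∀ ω : Config E, Conn ends ω a₂ o → Conn ends ω a₂ u) (hua : u ≠ a₂) :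
    prob p (TEvent ends u a₂ c ∩ connEvent ends u o) =
      prob p (connEvent ends u o) * prob p (TEvent ends u a₂ c) := by
  have h := SepK.prob_Q_clusterInK_conn_eq p ends a₂ o u hsep hua {W | c ∈ W}
  rw [ExploreA3.clusterInEvent_mem_eq, ← Sep.TEvent_eq ends a₂ c u] at h
  exact h

omit [DecidableEq V] in
/-- **`P(u ↔ o) · P(T, bL) ≤ P(T, oL, bL)`** on the class: explore `K = C(a₂)` avoiding `u`; the residual
probability of `u ↔ o` in `G ∖ K` is `P(u ↔ o)` (`Sep.conn_delConfig_iff`, roles of `u` and `a₂`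
exchanged), and `u ↔ o`, `u ↔ b` are positively correlated in `G ∖ K` (Harris). -/
lemma prob_T_oL_bL_ge (hp : IsProbVec p)
    (hsep : ∀ ω : Config E, Conn ends ω a₂ o → Conn ends ω a₂ u) (hua : u ≠ a₂) :
    prob p (connEvent ends u o) * prob p (TEvent ends u a₂ c ∩ connEvent ends u b) ≤
      prob p (TEvent ends u a₂ c ∩ (connEvent ends u o ∩ connEvent ends u b)) := by
  classical
  have hu : u ∈ ({u} : Finset V) := Finset.mem_singleton_self u
  have e1 := prob_clusterIn_inter_avoid_eq_expect p ends a₂ u hu {W | c ∈ W} {W | b ∈ W}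
  have e2 := prob_clusterIn_inter_avoid_eq_expect p ends a₂ u hu {W | c ∈ W}
    ({W | o ∈ W} ∩ {W | b ∈ W})
  have hcOB : clusterInEvent ends u ({W | o ∈ W} ∩ {W | b ∈ W}) =
      connEvent ends u o ∩ connEvent ends u b := rfl
  rw [ExploreA3.clusterInEvent_mem_eq, ExploreA3.clusterInEvent_mem_eq] at e1
  rw [ExploreA3.clusterInEvent_mem_eq, hcOB] at e2
  have hT1 : connEvent ends a₂ c ∩ connEvent ends u b ∩ avoidAll ends a₂ {u} =
      TEvent ends u a₂ c ∩ connEvent ends u b := by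
    rw [Sep.TEvent_eq ends a₂ c u]
    ext ω
    simp only [Set.mem_inter_iff]
    tauto
  have hT2 : connEvent ends a₂ c ∩ (connEvent ends u o ∩ connEvent ends u b) ∩ avoidAll ends a₂ {u} =
      TEvent ends u a₂ c ∩ (connEvent ends u o ∩ connEvent ends u b) := by
    rw [Sep.TEvent_eq ends a₂ c u]
    ext ω
    simp only [Set.mem_inter_iff]
    tauto
  rw [hT1] at e1
  rw [hT2] at e2
  rw [e1, e2, ← expect_const_mul]
  refine expect_mono hp fun ω => ?_
  by_cases hQ : ω ∈ avoidAll ends a₂ {u}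
  · have hQ' : ¬ Conn ends ω a₂ u := hQ u hu
    -- the residual `P(u ↔ o in G ∖ K)` is `P(u ↔ o)`
    have hgo : delClusterProb p ends u {W | o ∈ W} (cluster ends ω a₂) =
        prob p (connEvent ends u o) := by
      unfold delClusterProb
      congr 1
      ext ω'
      show Conn ends (delConfig ends (cluster ends ω a₂) ω') u o ↔ Conn ends ω' u o
      exact Sep.conn_delConfig_iff hsep (Ne.symm hua) hQ' ω'
    -- Harris in `G ∖ K`
    have hmono : ∀ 𝓥 : Set (Set V), IsUpperSet 𝓥 →
        IsUpperSet {ω' : Config E | cluster ends (delConfig ends (cluster ends ω a₂) ω') u ∈ 𝓥} := by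
      intro 𝓥 h𝓥 ω₁ ω₂ hle hω
      exact h𝓥 (cluster_mono (ExploreA3.delConfig_mono ends _ hle) u) hω
    have hH : delClusterProb p ends u {W | o ∈ W} (cluster ends ω a₂) *
        delClusterProb p ends u {W | b ∈ W} (cluster ends ω a₂) ≤
        delClusterProb p ends u ({W | o ∈ W} ∩ {W | b ∈ W}) (cluster ends ω a₂) := by
      simp only [delClusterProb]
      have h := prob_mul_prob_le_prob_inter hp (hmono {W | o ∈ W} (fun _ _ h hW => h hW))
        (hmono {W | b ∈ W} (fun _ _ h hW => h hW))
      refine h.trans (le_of_eq ?_)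
      congr 1
    rw [hgo] at hH
    have hi : (0 : R) ≤ ({W : Set V | c ∈ W}).indicator 1 (cluster ends ω a₂) :=
      Set.indicator_apply_nonneg fun _ => zero_le_one
    rw [Set.indicator_of_mem hQ]
    simp only [Pi.one_apply, mul_one]
    have h := mul_le_mul_of_nonneg_left hH hi
    linarith [h]
  · rw [Set.indicator_of_notMem hQ]
    simp

omit [Fintype E] [DecidableEq E] [Fintype V] [DecidableEq V] in
/-- `PD` is a decreasing event. -/
lemma isLowerSet_PD : IsLowerSet (PDEvent ends u a₂ c) := by
  intro ω ω' hle hω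
  refine ⟨fun h => hω.1 (conn_mono hle h), fun h => hω.2 ?_⟩
  rcases h with h | h
  · exact Or.inl (conn_mono hle h)
  · exact Or.inr (conn_mono hle h)

omit [Fintype E] [DecidableEq E] [Fintype V] [DecidableEq V] in
/-- The algebra of `(YB) ≥ 0` on the class: with `Yt = po·t`, `Y_N ≤ D·po`, `Y_N ≥ d0·Y` and `M ≥ po·B₁`,
`(YB) = B₀·(Y_N − d0·Y) + (d0·Z + D)·(M − po·B₁) + d0·B₁·(D·po − Y_N) + po·B₁·(d0·t′ + D)`. -/
lemma yb_alg {po d0 D t tp YN Yt M B1 PDbL TpbL : R}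
    (hpo : 0 ≤ po) (hd0 : 0 ≤ d0) (hD : 0 ≤ D) (ht : 0 ≤ t) (htp : 0 ≤ tp) (hB1 : 0 ≤ B1)
    (hPD : 0 ≤ PDbL) (hTp : 0 ≤ TpbL) (hYt : Yt = po * t) (hYN : YN ≤ D * po)
    (hTower : 0 ≤ YN - d0 * (YN + Yt)) (hM : po * B1 ≤ M) :
    0 ≤ (d0 * (D + t + tp) + D) * M + YN * (PDbL + TpbL) -
      d0 * (PDbL + B1 + TpbL) * (YN + Yt) := by
  have hA : 0 ≤ (d0 * (D + t + tp) + D) * (M - po * B1) :=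
    mul_nonneg (by positivity) (by linarith)
  have hB : 0 ≤ d0 * B1 * (D * po - YN) := mul_nonneg (mul_nonneg hd0 hB1) (by linarith)
  have hC : 0 ≤ po * B1 * (d0 * tp + D) := by positivity
  have hD' : 0 ≤ (PDbL + TpbL) * (YN - d0 * (YN + Yt)) := mul_nonneg (add_nonneg hPD hTp) hTower
  have key : (d0 * (D + t + tp) + D) * M + YN * (PDbL + TpbL) -
      d0 * (PDbL + B1 + TpbL) * (YN + Yt) =
      (PDbL + TpbL) * (YN - d0 * (YN + Yt)) + (d0 * (D + t + tp) + D) * (M - po * B1) +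
        d0 * B1 * (D * po - YN) + po * B1 * (d0 * tp + D) := by
    rw [hYt]
    ring
  rw [key]
  linarith

/-- **`(YB) ≥ 0` on the class**: `B₀·(Y_N − d0·Y) ≥ 0` (tower bound `prob_T_oL_le`) and
`(d0·Z + D)·M − d0·B₁·Y ≥ B₁·po·(d0·t′ + D) ≥ 0` (`prob_T_oL_bL_ge`, `prob_T_oL_eq`, mixed Harris
`Y_N ≤ po·D`). -/
theorem YB_nonneg_of_sepUO (hp : IsProbVec p)
    (hsep : ∀ ω : Config E, Conn ends ω a₂ o → Conn ends ω a₂ u) (hua : u ≠ a₂) :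
    0 ≤ (prob p (avoidAll ends a₂ {c}) * prob p (avoidAll ends a₂ {u}) + prob p (PDEvent ends u a₂ c)) *
          prob p (TEvent ends u a₂ c ∩ (connEvent ends u o ∩ connEvent ends u b)) +
        prob p (PDEvent ends u a₂ c ∩ connEvent ends u o) *
          (prob p (PDEvent ends u a₂ c ∩ connEvent ends u b) +
            prob p (TEvent ends a₂ u c ∩ connEvent ends u b)) -
        prob p (avoidAll ends a₂ {c}) * prob p (avoidAll ends a₂ {u} ∩ connEvent ends u b) *
          (prob p (PDEvent ends u a₂ c ∩ connEvent ends u o) +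
            prob p (TEvent ends u a₂ c ∩ connEvent ends u o)) := by
  have hM := prob_T_oL_bL_ge p ends o a₂ c b u hp hsep hua
  have hYt := prob_T_oL_eq p ends o a₂ c u hsep hua
  have hYN : prob p (PDEvent ends u a₂ c ∩ connEvent ends u o) ≤
      prob p (PDEvent ends u a₂ c) * prob p (connEvent ends u o) :=
    prob_inter_le_prob_mul_prob_of_isLowerSet hp (isLowerSet_PD ends a₂ c u)
      (isUpperSet_connEvent ends u o)
  have hTow := prob_T_oL_le p ends o a₂ c u hp
  have hY := ISplit.prob_PD_add_T p ends u a₂ c (connEvent ends u o)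
  have hd0 : prob p (avoidAll ends a₂ {c}) = 1 - prob p (connEvent ends a₂ c) := by
    rw [avoidAll_singleton_eq, prob_compl]
  have hZ := Qsplit_univ p ends u a₂ c
  have hQbL := Qsplit p ends u a₂ c (connEvent ends u b)
  have hTower : 0 ≤ prob p (PDEvent ends u a₂ c ∩ connEvent ends u o) -
      prob p (avoidAll ends a₂ {c}) * (prob p (PDEvent ends u a₂ c ∩ connEvent ends u o) +
        prob p (TEvent ends u a₂ c ∩ connEvent ends u o)) := by
    rw [hd0]
    rw [← hY] at hTow
    linarith [hTow]
  rw [hZ, hQbL]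
  exact yb_alg (prob_nonneg hp _) (prob_nonneg hp _) (prob_nonneg hp _) (prob_nonneg hp _)
    (prob_nonneg hp _) (prob_nonneg hp _) (prob_nonneg hp _) (prob_nonneg hp _) hYt hYN hTower hM

/-- **`0 ≤ T2oL` on the class** (`T2oL/2 = (YA) + (YB)`, `YA_nonneg`, `YB_nonneg_of_sepUO`). -/
theorem T2oL_nonneg_of_sepUO (hp : IsProbVec p)
    (hsep : ∀ ω : Config E, Conn ends ω a₂ o → Conn ends ω a₂ u) (hua : u ≠ a₂) :
    0 ≤ T2oL p ends o a₂ c b u := by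
  rw [T2oL_eq_YA_add_YB]
  have hA := YA_nonneg p ends o a₂ c b u hp
  have hB := YB_nonneg_of_sepUO p ends o a₂ c b u hp hsep hua
  linarith

/-- **`0 ≤ T2` on the class** (both halves). -/
theorem T2_nonneg_of_sepUO (hp : IsProbVec p)
    (hsep : ∀ ω : Config E, Conn ends ω a₂ o → Conn ends ω a₂ u) (hua : u ≠ a₂) :
    0 ≤ T2 p ends o a₂ c b u :=
  T2_nonneg_of_halves p ends o a₂ c b u (T2oL_nonneg_of_sepUO p ends o a₂ c b u hp hsep hua)
    (T2oK_nonneg_of_sepUO p ends o a₂ c b u hp hsep)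

/-- **(G4-u) on the class «`u` separates `a₂` from `o`» — a THEOREM**: for the root `a₁` a leaf at the
unmarked vertex `u` (edge `f`), if every configuration with `a₂ ↔ o` has `a₂ ↔ u`, then (HCOV) for the
root-leaf instance follows from (HCOV) for the instance `a₁ := u`. -/
theorem HCov_root_leaf_u_of_sepUO (hp : IsProbVec p) {f : E} {a₁ : V} (hf : ends f = s(a₁, u))
    (hleaf : ∀ e, a₁ ∈ ends e → e = f) (h1u : a₁ ≠ u) (h12 : a₁ ≠ a₂) (h1c : a₁ ≠ c)
    (h1o : a₁ ≠ o) (h1b : a₁ ≠ b) (hua : u ≠ a₂)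
    (hsep : ∀ ω : Config E, Conn ends ω a₂ o → Conn ends ω a₂ u)
    (h3 : HCov p ends o u a₂ c b) : HCov p ends o a₁ a₂ c b :=
  HCov_root_leaf_u_of p ends hp hf hleaf h1u h12 h1c h1o h1b
    (T2_nonneg_of_sepUO p ends o a₂ c b u hp hsep hua) h3

end SepUOL

end SepUO

end RootLeafU

end Summit.Ventures.PercRepro2
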